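import Summits.AtomisticToContinuum.HydrodynamicLimit.Theorems.ImplosionDichotomyPolynomialCompressionSolutionAPI
import Literature.Analysis.FunctionSpaces.TorusChainRule

/-!
# The hard-sphere Euler system in primitive variables (pointwise, in coordinates)

Helper file for the line `log-lipschitz-budget` of the crux
`ImplosionDichotomy.PolynomialCompression` (stub `stub_conditionalExistence`, component (c):
uniqueness of classical solutions). A classical solution `IsHardSphereEulerSolution σ T ρ u θ`
(`HardSphereEuler.lean`) is written in CONSERVATIVE form (`∂ₜρ`, `∂ₜ(ρu)`, `∂ₜE` against
divergences, `Torus.timeDerivWithin (Ico 0 T)` / `Torus.divergence` / `Torus.partialDeriv` /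
`Torus.gradient`). The energy method for the difference of two solutions needs the PRIMITIVE
form, pointwise on `[0, T) × 𝕋³` and in coordinates `i, j : Fin 3`:

* `hsEuler_density_eq`     — `∂ₜρ = -Σᵢ (ρ ∂ᵢuᵢ + ∂ᵢρ uᵢ)`;
* `hsEuler_velocity_eq`    — `ρ ∂ₜuⱼ = -ρ Σᵢ uᵢ ∂ᵢuⱼ - (θ (ζ(ρ) + ρ ζ'(ρ)) ∂ⱼρ + ρ ζ(ρ) ∂ⱼθ)`;
* `hsEuler_temperature_eq` — `∂ₜθ = -Σᵢ uᵢ ∂ᵢθ - (2/3) θ ζ(ρ) Σᵢ ∂ᵢuᵢ`,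

valid as soon as the pressure field is `p = ρ θ ζ(ρ)` pointwise on `[0, T) × 𝕋³` for SOME function
`ζ` smooth on an open set `J ⊆ ℝ` containing all values of the density (for the hard-sphere law
`p = ρ θ Z(ρσ³)` this is `ζ r = Z(r σ³)` once the compressibility factor `Z` is known to be smooth
on the packing range — the unbundled equation-of-state hypothesis of the stub; nothing about
`hsCompressibility` itself is assumed here). The proofs are the textbook manipulations
(`∂ₜ(ρu) = ρ∂ₜu + u∂ₜρ`, `Σᵢ∂ᵢ(ρuᵢu) = ρ(u·∇)u + u div(ρu)`, `E = ρ(|u|²/2 + 3θ/2)`,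
`div((E+p)u) = …`, then the mass equation cancels the `u`-multiples and the momentum equation the
kinetic part), carried out with one-variable derivatives along coordinate lines
(`Torus.hasDerivAt_comp_add_proj_smul`) and time slices
(`Torus.IsSmoothSpaceTimeOn.hasDerivWithinAt_slice`) and closed by `linear_combination`.
-/

noncomputable section

namespace Summit.AtomisticToContinuum.HydrodynamicLimit.Theorems

open Set Filter Topology MeasureTheory
open scoped ContDiff
open Literature.MathematicalPhysics.KineticTheory Literature.Analysis.FunctionSpaces

/-! ### Pointwise calculus along coordinate lines and time slices -/

/-- A `C¹` scalar function on `𝕋³` restricted to the `i`-th coordinate line through `x` has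
derivative `∂ᵢa(x)` at parameter `0`. [folklore] -/
theorem hasDerivAt_coordLine {a : T3 → ℝ} (ha : Torus.IsContDiff 1 a) (x : T3) (i : Fin 3) :
    HasDerivAt (fun s : ℝ => a (x + Torus.proj (s • EuclideanSpace.single i (1 : ℝ))))
      (Torus.partialDeriv i a x) 0 := by
  have h := Torus.hasDerivAt_comp_add_proj_smul ha x (EuclideanSpace.single i (1 : ℝ)) 0
  simp only [zero_smul, Torus.proj_zero, add_zero] at h
  exact h

/-- Chain rule along a coordinate line: `s ↦ ζ(a(x + s eᵢ))` has derivative `ζ'(a x) ∂ᵢa(x)` at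
`0` when `ζ` is smooth on an open set containing `a x`. [folklore] -/
theorem hasDerivAt_coordLine_comp {a : T3 → ℝ} (ha : Torus.IsContDiff 1 a) {ζ : ℝ → ℝ}
    {J : Set ℝ} (hJ : IsOpen J) (hζ : ContDiffOn ℝ ∞ ζ J) (x : T3) (hx : a x ∈ J) (i : Fin 3) :
    HasDerivAt (fun s : ℝ => ζ (a (x + Torus.proj (s • EuclideanSpace.single i (1 : ℝ)))))
      (deriv ζ (a x) * Torus.partialDeriv i a x) 0 := by
  have hd : HasDerivAt ζ (deriv ζ (a x)) (a x) :=
    ((hζ.differentiableOn (by simp)).differentiableAt (hJ.mem_nhds hx)).hasDerivAt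
  have hd' : HasDerivAt ζ (deriv ζ (a x))
      (a (x + Torus.proj ((0 : ℝ) • EuclideanSpace.single i (1 : ℝ)))) := by
    simpa only [zero_smul, Torus.proj_zero, add_zero] using hd
  exact hd'.comp (0 : ℝ) (hasDerivAt_coordLine ha x i)

/-- The partial derivative `∂ᵢF(x)` is the derivative of `F` along the `i`-th coordinate line
through `x` (by definition; uniqueness of derivatives). [folklore] -/
theorem partialDeriv_eq_of_hasDerivAt {F : T3 → ℝ} {x : T3} {i : Fin 3} {f' : ℝ}
    (h : HasDerivAt (fun s : ℝ => F (x + Torus.proj (s • EuclideanSpace.single i (1 : ℝ)))) f' 0) :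
    Torus.partialDeriv i F x = f' :=
  h.deriv

/-- The one-sided time derivative is read off from a `HasDerivWithinAt` of the time slice
(uniqueness of one-sided derivatives on sets of unique differentiability). [folklore] -/
theorem timeDerivWithin_eq_of_hasDerivWithinAt {S : Set ℝ} {F : ℝ → T3 → ℝ} {t : ℝ} {x : T3}
    {f' : ℝ} (h : HasDerivWithinAt (fun τ : ℝ => F τ x) f' S t) (hS : UniqueDiffWithinAt ℝ S t) :
    Torus.timeDerivWithin S F t x = f' :=
  h.derivWithin hS

/-- Coordinates commute with one-sided time derivatives of jointly smooth vector fields.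
[folklore] -/
theorem timeDerivWithin_apply_coord {S : Set ℝ} {F : ℝ → T3 → V3}
    (hF : Torus.IsSmoothSpaceTimeOn S F) (hS : UniqueDiffOn ℝ S) {t : ℝ} (ht : t ∈ S) (x : T3)
    (j : Fin 3) :
    Torus.timeDerivWithin S (fun s y => F s y j) t x = Torus.timeDerivWithin S F t x j :=
  ((EuclideanSpace.proj j : V3 →L[ℝ] ℝ).hasFDerivAt.comp_hasDerivWithinAt t
    (hF.hasDerivWithinAt_slice ht x)).derivWithin (hS t ht)

/-- Coordinates of the torus gradient are the partial derivatives. [folklore] -/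
theorem gradient_apply_eq_partialDeriv {p : T3 → ℝ} (hp : Torus.IsContDiff 1 p) (x : T3)
    (j : Fin 3) : Torus.gradient p x j = Torus.partialDeriv j p x := by
  rw [Torus.gradient_eq_sum_partialDeriv hp]
  simp [Finset.sum_apply, Pi.single_apply]

/-- Coordinates of a `C¹` vector field on `𝕋³` are `C¹`. [folklore] -/
theorem isContDiff_apply_coord {v : T3 → V3} (hv : Torus.IsContDiff 1 v) (j : Fin 3) :
    Torus.IsContDiff 1 (fun y => v y j) :=
  (EuclideanSpace.proj j : V3 →L[ℝ] ℝ).contDiff.comp hv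

/-! ### The primitive equations -/

section Primitive

variable {σ T : ℝ} {ρ θ : ℝ → T3 → ℝ} {u : ℝ → T3 → V3} {ζ : ℝ → ℝ} {J : Set ℝ}

/-- **Mass equation in primitive form**: along a classical hard-sphere–Euler solution,
`∂ₜρ = -Σᵢ (ρ ∂ᵢuᵢ + ∂ᵢρ uᵢ)` pointwise on `[0, T) × 𝕋³`. [folklore] -/
theorem hsEuler_density_eq (hE : IsHardSphereEulerSolution σ T ρ u θ) {t : ℝ} (ht : t ∈ Ico 0 T)
    (x : T3) :
    Torus.timeDerivWithin (Ico 0 T) ρ t x =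
      -∑ i, (ρ t x * Torus.partialDeriv i (fun y => u t y i) x +
        Torus.partialDeriv i (ρ t) x * u t x i) := by
  have hρ1 : Torus.IsContDiff 1 (ρ t) := (hE.smooth_density.isSmooth_slice ht).isContDiff (by simp)
  have hu1 : Torus.IsContDiff 1 (u t) := (hE.smooth_velocity.isSmooth_slice ht).isContDiff (by simp)
  have hdiv : Torus.divergence (fun y => ρ t y • u t y) x =
      ∑ i, (ρ t x * Torus.partialDeriv i (fun y => u t y i) x +
        Torus.partialDeriv i (ρ t) x * u t x i) := by
    unfold Torus.divergence
    refine Finset.sum_congr rfl fun i _ => ?_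
    have hfun : (fun y => (ρ t y • u t y) i) = fun y => ρ t y * u t y i := by
      funext y; simp [smul_eq_mul]
    rw [hfun]
    exact Torus.partialDeriv_mul hρ1 (isContDiff_apply_coord hu1 i) i x
  linear_combination hE.mass t ht x - hdiv

/-- **Momentum equation in primitive form**: along a classical hard-sphere–Euler solution whose
pressure field is `ρ θ ζ(ρ)` for a function `ζ` smooth on an open set containing the values of
the density, `ρ ∂ₜuⱼ = -ρ Σᵢ uᵢ ∂ᵢuⱼ - (θ (ζ(ρ) + ρ ζ'(ρ)) ∂ⱼρ + ρ ζ(ρ) ∂ⱼθ)` pointwise on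
`[0, T) × 𝕋³` (`∂ⱼp = p_ρ ∂ⱼρ + p_θ ∂ⱼθ`; the mass equation cancels `uⱼ(∂ₜρ + div(ρu))`).
[folklore] -/
theorem hsEuler_velocity_eq (hE : IsHardSphereEulerSolution σ T ρ u θ) (hJ : IsOpen J)
    (hζ : ContDiffOn ℝ ∞ ζ J) (hρJ : ∀ t ∈ Ico 0 T, ∀ x, ρ t x ∈ J)
    (hp : ∀ t ∈ Ico 0 T, ∀ x, hsPressure σ (ρ t x) (θ t x) = ρ t x * θ t x * ζ (ρ t x))
    {t : ℝ} (ht : t ∈ Ico 0 T) (x : T3) (j : Fin 3) :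
    ρ t x * Torus.timeDerivWithin (Ico 0 T) (fun s y => u s y j) t x =
      -(ρ t x * ∑ i, u t x i * Torus.partialDeriv i (fun y => u t y j) x) -
        (θ t x * (ζ (ρ t x) + ρ t x * deriv ζ (ρ t x)) * Torus.partialDeriv j (ρ t) x +
          ρ t x * ζ (ρ t x) * Torus.partialDeriv j (θ t) x) := by
  have hU : UniqueDiffOn ℝ (Ico (0 : ℝ) T) := uniqueDiffOn_Ico 0 T
  have hρ1 : Torus.IsContDiff 1 (ρ t) := (hE.smooth_density.isSmooth_slice ht).isContDiff (by simp)
  have hθ1 : Torus.IsContDiff 1 (θ t) :=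
    (hE.smooth_temperature.isSmooth_slice ht).isContDiff (by simp)
  have hu1 : Torus.IsContDiff 1 (u t) := (hE.smooth_velocity.isSmooth_slice ht).isContDiff (by simp)
  have huj1 : ∀ i, Torus.IsContDiff 1 (fun y => u t y i) := fun i => isContDiff_apply_coord hu1 i
  have hζ1 : Torus.IsContDiff 1 (fun y => ζ (ρ t y)) :=
    (hζ.of_le (by simp)).comp_contDiff hρ1 fun v => hρJ t ht _
  -- coordinate-line derivatives of the basic fields at `x`
  have cρ := fun i => hasDerivAt_coordLine hρ1 x i
  have cθ := fun i => hasDerivAt_coordLine hθ1 x i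
  have cu := fun i k => hasDerivAt_coordLine (huj1 k) x i
  have cζ := fun i => hasDerivAt_coordLine_comp hρ1 hJ hζ x (hρJ t ht x) i
  -- the `j`-th coordinate of the momentum equation
  have hmj : (Torus.timeDerivWithin (Ico 0 T) (fun s y => ρ s y • u s y) t x +
      (∑ i, Torus.partialDeriv i (fun y => (ρ t y * u t y i) • u t y) x) +
      Torus.gradient (fun y => hsPressure σ (ρ t y) (θ t y)) x) j = 0 := by
    rw [hE.momentum t ht x]; rfl
  -- (1) `∂ₜ(ρuⱼ) = ∂ₜρ uⱼ + ρ ∂ₜuⱼ`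
  have hA : (Torus.timeDerivWithin (Ico 0 T) (fun s y => ρ s y • u s y) t x) j =
      Torus.timeDerivWithin (Ico 0 T) ρ t x * u t x j +
        ρ t x * Torus.timeDerivWithin (Ico 0 T) (fun s y => u s y j) t x := by
    rw [← timeDerivWithin_apply_coord (hE.smooth_density.smul hE.smooth_velocity) hU ht x j]
    have hfun : (fun s y => (ρ s y • u s y) j) = fun s y => ρ s y * u s y j := by
      funext s y; simp [smul_eq_mul]
    rw [hfun]
    exact timeDerivWithin_eq_of_hasDerivWithinAt
      (((hE.smooth_density.hasDerivWithinAt_slice ht x).fun_mul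
        ((hE.smooth_velocity.apply j).hasDerivWithinAt_slice ht x)).congr_deriv (by ring)) (hU t ht)
  -- (2) `Σᵢ ∂ᵢ(ρuᵢuⱼ) = Σᵢ (ρuᵢ ∂ᵢuⱼ + (ρ ∂ᵢuᵢ + ∂ᵢρ uᵢ) uⱼ)`
  have hB : (∑ i, Torus.partialDeriv i (fun y => (ρ t y * u t y i) • u t y) x) j =
      ∑ i, (ρ t x * u t x i * Torus.partialDeriv i (fun y => u t y j) x +
        (ρ t x * Torus.partialDeriv i (fun y => u t y i) x +
          Torus.partialDeriv i (ρ t) x * u t x i) * u t x j) := by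
    have hsum : (∑ i, Torus.partialDeriv i (fun y => (ρ t y * u t y i) • u t y) x) j =
        ∑ i, Torus.partialDeriv i (fun y => (ρ t y * u t y i) • u t y) x j := by simp
    rw [hsum]
    refine Finset.sum_congr rfl fun i _ => ?_
    have hF1 : Torus.IsContDiff 1 (fun y => (ρ t y * u t y i) • u t y) :=
      ((hρ1.mul (huj1 i)).smul hu1 :)
    rw [← Torus.partialDeriv_apply_coord hF1 i x j]
    have hfun : (fun y => ((ρ t y * u t y i) • u t y) j) = fun y => ρ t y * u t y i * u t y j := by
      funext y; simp [smul_eq_mul]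
    rw [hfun]
    exact partialDeriv_eq_of_hasDerivAt ((((cρ i).fun_mul (cu i i)).fun_mul (cu i j)).congr_deriv
      (by simp only [zero_smul, Torus.proj_zero, add_zero]; ring))
  -- (3) `∂ⱼp = θ (ζ(ρ) + ρ ζ'(ρ)) ∂ⱼρ + ρ ζ(ρ) ∂ⱼθ`
  have hC : (Torus.gradient (fun y => hsPressure σ (ρ t y) (θ t y)) x) j =
      θ t x * (ζ (ρ t x) + ρ t x * deriv ζ (ρ t x)) * Torus.partialDeriv j (ρ t) x +
        ρ t x * ζ (ρ t x) * Torus.partialDeriv j (θ t) x := by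
    have hpf : (fun y => hsPressure σ (ρ t y) (θ t y)) = fun y => ρ t y * θ t y * ζ (ρ t y) :=
      funext (hp t ht)
    have hp1 : Torus.IsContDiff 1 (fun y => ρ t y * θ t y * ζ (ρ t y)) := ((hρ1.mul hθ1).mul hζ1 :)
    rw [hpf, gradient_apply_eq_partialDeriv hp1 x j]
    exact partialDeriv_eq_of_hasDerivAt ((((cρ j).fun_mul (cθ j)).fun_mul (cζ j)).congr_deriv
      (by simp only [zero_smul, Torus.proj_zero, add_zero]; ring))
  have hP1 := hsEuler_density_eq hE ht x
  have hmj' : Torus.timeDerivWithin (Ico 0 T) ρ t x * u t x j +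
      ρ t x * Torus.timeDerivWithin (Ico 0 T) (fun s y => u s y j) t x +
      (∑ i, (ρ t x * u t x i * Torus.partialDeriv i (fun y => u t y j) x +
        (ρ t x * Torus.partialDeriv i (fun y => u t y i) x +
          Torus.partialDeriv i (ρ t) x * u t x i) * u t x j)) +
      (θ t x * (ζ (ρ t x) + ρ t x * deriv ζ (ρ t x)) * Torus.partialDeriv j (ρ t) x +
        ρ t x * ζ (ρ t x) * Torus.partialDeriv j (θ t) x) = 0 := by
    have h := hmj
    simp only [PiLp.add_apply] at h
    rwa [hA, hB, hC] at h
  simp only [Fin.sum_univ_three] at hmj' hP1 ⊢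
  linear_combination hmj' - (u t x j) * hP1

/-- **Temperature equation in primitive form**: along a classical hard-sphere–Euler solution whose
pressure field is `ρ θ ζ(ρ)` for a function `ζ` smooth on an open set containing the values of
the density, `∂ₜθ = -Σᵢ uᵢ ∂ᵢθ - (2/3) θ ζ(ρ) Σᵢ ∂ᵢuᵢ` pointwise on `[0, T) × 𝕋³` (energy equation
minus `(|u|²/2 + 3θ/2)`·mass minus `u`·momentum, divided by `(3/2)ρ > 0`). [folklore] -/
theorem hsEuler_temperature_eq :
    ∀ {σ T : ℝ} {ρ θ : ℝ → T3 → ℝ} {u : ℝ → T3 → V3} {ζ : ℝ → ℝ} {J : Set ℝ},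
      IsHardSphereEulerSolution σ T ρ u θ → IsOpen J → ContDiffOn ℝ (⊤ : ℕ∞) ζ J →
      (∀ t ∈ Ico 0 T, ∀ x, ρ t x ∈ J) →
      (∀ t ∈ Ico 0 T, ∀ x, hsPressure σ (ρ t x) (θ t x) = ρ t x * θ t x * ζ (ρ t x)) →
      ∀ {t : ℝ}, t ∈ Ico 0 T → ∀ x : T3,
        Torus.timeDerivWithin (Ico 0 T) θ t x =
          -(∑ i, u t x i * Torus.partialDeriv i (θ t) x) -
            2 / 3 * (θ t x * ζ (ρ t x)) * ∑ i, Torus.partialDeriv i (fun y => u t y i) x := by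
  intro σ T ρ θ u ζ J hE hJ hζ hρJ hp t ht x
  have hU : UniqueDiffOn ℝ (Ico (0 : ℝ) T) := uniqueDiffOn_Ico 0 T
  have hρ1 : Torus.IsContDiff 1 (ρ t) := (hE.smooth_density.isSmooth_slice ht).isContDiff (by simp)
  have hθ1 : Torus.IsContDiff 1 (θ t) :=
    (hE.smooth_temperature.isSmooth_slice ht).isContDiff (by simp)
  have hu1 : Torus.IsContDiff 1 (u t) := (hE.smooth_velocity.isSmooth_slice ht).isContDiff (by simp)
  have huj1 : ∀ i, Torus.IsContDiff 1 (fun y => u t y i) := fun i => isContDiff_apply_coord hu1 i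
  -- coordinate-line derivatives of the basic fields at `x`
  have cρ := fun i => hasDerivAt_coordLine hρ1 x i
  have cθ := fun i => hasDerivAt_coordLine hθ1 x i
  have cu := fun i k => hasDerivAt_coordLine (huj1 k) x i
  have cζ := fun i => hasDerivAt_coordLine_comp hρ1 hJ hζ x (hρJ t ht x) i
  -- time-slice derivatives
  have sρ := hE.smooth_density.hasDerivWithinAt_slice ht x
  have sθ := hE.smooth_temperature.hasDerivWithinAt_slice ht x
  have su := fun k => (hE.smooth_velocity.apply k).hasDerivWithinAt_slice ht x
  -- the energy density and the energy flux in coordinates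
  have hEf : (fun s y => totalEnergyDensity (ρ s y) (u s y) (θ s y)) = fun s y =>
      ρ s y * (((u s y 0) ^ 2 + (u s y 1) ^ 2 + (u s y 2) ^ 2) / 2 + 3 / 2 * θ s y) := by
    funext s y
    simp only [totalEnergyDensity, EuclideanSpace.norm_sq_eq, Fin.sum_univ_three, Real.norm_eq_abs,
      sq_abs]
  have hFf : ∀ i, (fun y => ((totalEnergyDensity (ρ t y) (u t y) (θ t y) +
      hsPressure σ (ρ t y) (θ t y)) • u t y) i) = fun y =>
      (ρ t y * (((u t y 0) ^ 2 + (u t y 1) ^ 2 + (u t y 2) ^ 2) / 2 + 3 / 2 * θ t y) +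
        ρ t y * θ t y * ζ (ρ t y)) * u t y i := by
    intro i
    funext y
    simp only [PiLp.smul_apply, smul_eq_mul, totalEnergyDensity, EuclideanSpace.norm_sq_eq,
      Fin.sum_univ_three, Real.norm_eq_abs, sq_abs, hp t ht y]
  -- the energy equation in coordinates
  have hen := hE.energy t ht x
  rw [hEf] at hen
  unfold Torus.divergence at hen
  simp only [hFf] at hen
  -- (1) the time derivative of the energy density
  have hA : Torus.timeDerivWithin (Ico 0 T) (fun s y =>
      ρ s y * (((u s y 0) ^ 2 + (u s y 1) ^ 2 + (u s y 2) ^ 2) / 2 + 3 / 2 * θ s y)) t x =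
      Torus.timeDerivWithin (Ico 0 T) ρ t x *
          (((u t x 0) ^ 2 + (u t x 1) ^ 2 + (u t x 2) ^ 2) / 2 + 3 / 2 * θ t x) +
        ρ t x * (u t x 0 * Torus.timeDerivWithin (Ico 0 T) (fun s y => u s y 0) t x +
          u t x 1 * Torus.timeDerivWithin (Ico 0 T) (fun s y => u s y 1) t x +
          u t x 2 * Torus.timeDerivWithin (Ico 0 T) (fun s y => u s y 2) t x +
          3 / 2 * Torus.timeDerivWithin (Ico 0 T) θ t x) :=
    timeDerivWithin_eq_of_hasDerivWithinAt ((sρ.fun_mul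
      ((((((su 0).fun_pow 2).fun_add ((su 1).fun_pow 2)).fun_add ((su 2).fun_pow 2)).div_const
        2).fun_add (sθ.const_mul (3 / 2)))).congr_deriv (by ring)) (hU t ht)
  -- (2) the divergence of the energy flux, coordinate by coordinate
  have hB : ∀ i, Torus.partialDeriv i (fun y =>
      (ρ t y * (((u t y 0) ^ 2 + (u t y 1) ^ 2 + (u t y 2) ^ 2) / 2 + 3 / 2 * θ t y) +
        ρ t y * θ t y * ζ (ρ t y)) * u t y i) x =
      (ρ t x * (((u t x 0) ^ 2 + (u t x 1) ^ 2 + (u t x 2) ^ 2) / 2 + 3 / 2 * θ t x) +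
        ρ t x * θ t x * ζ (ρ t x)) * Torus.partialDeriv i (fun y => u t y i) x +
      ((Torus.partialDeriv i (ρ t) x * (((u t x 0) ^ 2 + (u t x 1) ^ 2 + (u t x 2) ^ 2) / 2 +
          3 / 2 * θ t x) +
        ρ t x * (u t x 0 * Torus.partialDeriv i (fun y => u t y 0) x +
          u t x 1 * Torus.partialDeriv i (fun y => u t y 1) x +
          u t x 2 * Torus.partialDeriv i (fun y => u t y 2) x +
          3 / 2 * Torus.partialDeriv i (θ t) x)) +
        (θ t x * (ζ (ρ t x) + ρ t x * deriv ζ (ρ t x)) * Torus.partialDeriv i (ρ t) x +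
          ρ t x * ζ (ρ t x) * Torus.partialDeriv i (θ t) x)) * u t x i := by
    intro i
    exact partialDeriv_eq_of_hasDerivAt (((((cρ i).fun_mul
      ((((((cu i 0).fun_pow 2).fun_add ((cu i 1).fun_pow 2)).fun_add ((cu i 2).fun_pow 2)).div_const
        2).fun_add ((cθ i).const_mul (3 / 2)))).fun_add
      (((cρ i).fun_mul (cθ i)).fun_mul (cζ i))).fun_mul (cu i i)).congr_deriv
      (by simp only [zero_smul, Torus.proj_zero, add_zero]; ring))
  rw [hA] at hen
  simp only [hB] at hen
  have hP1 := hsEuler_density_eq hE ht x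
  have hP2 := fun k => hsEuler_velocity_eq hE hJ hζ hρJ hp ht x k
  have hP20 := hP2 0
  have hP21 := hP2 1
  have hP22 := hP2 2
  simp only [Fin.sum_univ_three] at hen hP1 hP20 hP21 hP22 ⊢
  have hρ0 : ρ t x ≠ 0 := (hE.density_pos t ht x).ne'
  have key : 3 / 2 * ρ t x * (Torus.timeDerivWithin (Ico 0 T) θ t x -
      (-(u t x 0 * Torus.partialDeriv 0 (θ t) x + u t x 1 * Torus.partialDeriv 1 (θ t) x +
          u t x 2 * Torus.partialDeriv 2 (θ t) x) -
        2 / 3 * (θ t x * ζ (ρ t x)) * (Torus.partialDeriv 0 (fun y => u t y 0) x +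
          Torus.partialDeriv 1 (fun y => u t y 1) x + Torus.partialDeriv 2 (fun y => u t y 2) x))) =
      0 := by
    linear_combination hen -
      (((u t x 0) ^ 2 + (u t x 1) ^ 2 + (u t x 2) ^ 2) / 2 + 3 / 2 * θ t x) * hP1 -
      (u t x 0) * hP20 - (u t x 1) * hP21 - (u t x 2) * hP22
  have h32 : (3 / 2 * ρ t x : ℝ) ≠ 0 := mul_ne_zero (by norm_num) hρ0
  exact sub_eq_zero.1 ((mul_eq_zero.1 key).resolve_left h32)

end Primitive

end Summit.AtomisticToContinuum.HydrodynamicLimit.Theorems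

end
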